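import Summits.QuantumFields.BalabanUV.Beta.GAN24.CombExchangeESectorStaircase
import Summits.QuantumFields.BalabanUV.Beta.GAN24.ExchangeESectorValue

/-!
# `BalabanUV.Beta.GAN24.CombExchangeESectorValue` — binder row G-an2-4 ∕ (CONV-C), W-slot CT-W, the COMB chart (III′), J2_comb step T3: **THE `E ⊗ E` EXCHANGE WORD OF THE COMB CUBIC
# SECTOR `cE • V^c_j`, VALUED** — leaf-06 g54's `ExchangeESectorValue` TOKEN FOR TOKEN with the member replaced (`SrecAt … j ↦ 𝒯S̃comb_j` at the Ward pins, kernel root `toSite (ctrOff (d+1) Lc)`):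
# `word(μν;αβ) = −¼·|box|·c₀σ_{j+1}²·K_E²·s_f²·wVH_{j+1}⁻¹·Σ_{x∈box} Σ_b q_{μα}(b,x)·(E2_{j+1} q_{νβ})(b,x)` for `μ ≠ α`, `ν ≠ β`, and `word = 0` if `μ = α` or `ν = β` — after T2 the proof is
# member-FREE (leaf-06's `sum_box_E2T_mul_dressedStep_E2_apply`, `stairFace_eq_periodic(_fst)`, `stairFace_diag_eq_zero(_fst)`, `qProfile_*` BY NAME)

NOT IN PRINT; OUR BOOKKEEPING ([folklore] BY NAME; G-an2-4 formalisation swarm, leaf prover `b2b-balaban-gan24-formalise-leaf-01`, gen 87, file T3; 0 `def`, 0 cited facts, 0 `def … : Prop`,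
0 sorry).  WHAT: `exchangeWord_sector_value`, `exchangeWord_sector_eq_zero_of_right_diag`, `exchangeWord_sector_eq_zero_of_left_diag` — same names as leaf-06's, namespace
`CombExchangeESectorValue`, signature `(cΛt sf sm cE cΛ : ℝ) (j : ℕ) …` (no root hypothesis: the comb root `ctrOff (d+1) Lc ∈ box` by `ctrOff_mem_box`).  Asserts NO value of Bałaban's
tables beyond an2's ∕ an1's DEFINED ones; NEVER «G-an2-4 closed» as (CONV-C); NOT D1, NOT `BetaPertH`, NOT continuum, NOT Clay.  2026-08-27; no existing file touched.

HONEST FRAMING (cell contract, verbatim): «discharging `BetaPertH` makes Bałaban's UV stability UNCONDITIONAL — a real constructive-QFT result; it is NOT the continuum limit and NOT the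
Clay problem.»  HONEST DEPENDENCY (verbatim): «continuum YM on T⁴ ⇐ BetaPertH ∧ nine spine estimates (0/9 proved); BetaPertH ⇐ (D1) ∧ (D4) ∧ CAP+tail; G-an2-4 gates asym, D1 and NE2/3/4.»
-/

noncomputable section

open Finset
open scoped BigOperators
open Literature.MathematicalPhysics.QuantumFieldTheory
open Literature.MathematicalPhysics.QuantumFieldTheory.Balaban1983to89
open Literature.MathematicalPhysics.QuantumFieldTheory.Balaban1983to89.Beta
open ExpKernelCalculus (Site MKer)
open OneStepResolventKernel (Fib)
open OneStepKernelFamily (KInvStep vertexOfK)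
open AffineAveraging (box toSite)
open BalabanStepJetsSucc (E2 wVH)
open Summit.QuantumFields.BalabanUV.Beta.AxialDressingRooted (coDressKBmAt one_le_of_neZero)
open Summit.QuantumFields.BalabanUV.Beta.HessKerDressedUnits (unitK unitS)
open Summit.QuantumFields.BalabanUV.Beta.SpineRooted (e3OfK)
open Summit.QuantumFields.BalabanUV.Beta.WardLocusRecursive (SrecAt)
open Summit.QuantumFields.BalabanUV.Beta.GAN24.ExchangeE2E2ChannelValue (sum_box_E2T_mul_dressedStep_E2_apply)
open Summit.QuantumFields.BalabanUV.Beta.GAN24.StaircaseCurrentAntisymm (stairFace_diag_eq_zero stairFace_diag_eq_zero_fst)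
open Summit.QuantumFields.BalabanUV.Beta.GAN24.StaircaseCurrentPeriodic (stairFace_eq_periodic stairFace_eq_periodic_fst qProfile_translate abs_qProfile_le contourSum_qProfile_eq_zero)

open ExpKernelCalculus (comp)
open AveragingContoursRooted (ctr ctrOff ctrOff_mem_box)
open Summit.QuantumFields.BalabanUV.Beta.TameKernelCalculus (trK)
open Summit.QuantumFields.BalabanUV.Beta.SymSecondOrderTablesAn1 (symTablesAn1S2)
open Summit.QuantumFields.BalabanUV.Beta.CombChartStepJets (ScombOf)
open Summit.QuantumFields.BalabanUV.Beta.SymCorrectorKernel (psiKS)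
open Summit.QuantumFields.BalabanUV.Beta.SymCorrectorFace (slotPsiS)
open Summit.QuantumFields.BalabanUV.Beta.GAN24.CombTransportedBorder (pos_Lc)
open Summit.QuantumFields.BalabanUV.Beta.GAN24.CombExchangeESectorStaircase (exchangeWord_sector_eq_stair)
namespace Summit.QuantumFields.BalabanUV.Beta.GAN24.CombExchangeESectorValue

variable {d : ℕ} {Lc : ℕ} [NeZero Lc]

/-! ## §1 The E-sector EE word, valued -/

/-- [folklore] **THE E-SECTOR EE WORD OF ROW (C) AT LEVEL `j+1`, VALUED** (`μ ≠ α`, `ν ≠ β`; every `j`, in-block root, all units, amplitude `cE`, any `cΛ`):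
`word = |box|·c₀σ_{j+1}²·(K_E·(−½))·(K_E·½)·sf²·wVH_{j+1}⁻¹·Σ_{x∈box} Σ_b q_{μα}(b,x)·Σ'_s Σ_{b′} E2_{j+1}(x,s)_{bb′}·q_{νβ}(b′,s)`. -/
theorem exchangeWord_sector_value (cΛt sf sm cE cΛ : ℝ) (j : ℕ) {μ α ν β : Fin (d + 1)} (hμα : μ ≠ α) (hνβ : ν ≠ β) :
    ∑ u ∈ box (d + 1) Lc, ∑' y₁ : Site (d + 1), ∑ a : Fin (d + 1),
        (∑' y : Site (d + 1), (if y α % (Lc : ℤ) = (Lc : ℤ) - 1 then (1 : ℝ) else 0) *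
          vertexOfK (unitK sf sm (coDressKBmAt (toSite (ctrOff (d + 1) Lc)) Lc (KInvStep (d := d) Lc (j + 1)))) Lc
            (unitS sf sm (fun κ u => cE • e3OfK Lc (coDressKBmAt (toSite (ctrOff (d + 1) Lc)) Lc (KInvStep (d := d) Lc j))
              (fun κ u => comp (comp (trK (psiKS (ctrOff (d + 1) Lc) Lc)) (slotPsiS (ctrOff (d + 1) Lc) Lc (ScombOf (symTablesAn1S2 d Lc cΛt) ((Lc : ℝ) ^ (d + 1)) (-((Lc : ℝ) ^ (d + 1) * (1 / 2) * (Lc : ℝ) ^ (d + 1))) cΛ j) κ u)) (psiKS (ctrOff (d + 1) Lc) Lc)) κ u)) μ (toSite u) y y₁ (Sum.inl α) (Sum.inl a)) *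
        (∑' z : Site (d + 1), ∑ b : Fin (d + 1), unitK sf sm (coDressKBmAt (toSite (ctrOff (d + 1) Lc)) Lc (KInvStep (d := d) Lc (j + 1))) y₁ z (Sum.inl a) (Sum.inl b) *
          (∑' u' : Site (d + 1), ∑' w : Site (d + 1), (if w β % (Lc : ℤ) = (Lc : ℤ) - 1 then (1 : ℝ) else 0) *
            vertexOfK (unitK sf sm (coDressKBmAt (toSite (ctrOff (d + 1) Lc)) Lc (KInvStep (d := d) Lc (j + 1)))) Lc
              (unitS sf sm (fun κ u => cE • e3OfK Lc (coDressKBmAt (toSite (ctrOff (d + 1) Lc)) Lc (KInvStep (d := d) Lc j))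
                (fun κ u => comp (comp (trK (psiKS (ctrOff (d + 1) Lc) Lc)) (slotPsiS (ctrOff (d + 1) Lc) Lc (ScombOf (symTablesAn1S2 d Lc cΛt) ((Lc : ℝ) ^ (d + 1)) (-((Lc : ℝ) ^ (d + 1) * (1 / 2) * (Lc : ℝ) ^ (d + 1))) cΛ j) κ u)) (psiKS (ctrOff (d + 1) Lc) Lc)) κ u)) ν u' z w (Sum.inl b) (Sum.inl β))) =
      ((box (d + 1) Lc).card : ℝ) * (((Lc : ℝ) * (sm * sf)) * ((((Lc ^ (j + 1 + 1) : ℕ) : ℝ)) ^ (d + 1 + 1))⁻¹) ^ 2 *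
        ((((sf * sm)⁻¹ * (sf⁻¹ * sf⁻¹) * cE) * (-(1 / 2 : ℝ))) * (((sf * sm)⁻¹ * (sf⁻¹ * sf⁻¹) * cE) * (1 / 2 : ℝ)) *
          ((sf * sf) * ((wVH d Lc (j + 1))⁻¹ *
            ∑ x ∈ box (d + 1) Lc, ∑ b : Fin (d + 1),
              ((if b = μ then ((Lc : ℝ)⁻¹ * (Lc : ℝ)⁻¹) * ((((toSite x α % (Lc : ℤ) : ℤ) : ℝ) - ((Lc : ℝ) - 1) / 2)) else 0)
                + (if b = α then (-(Lc : ℝ)⁻¹ * ((((toSite x μ % (Lc : ℤ) : ℤ) : ℝ) - ((Lc : ℝ) - 1) / 2))) * (if toSite x α % (Lc : ℤ) = (Lc : ℤ) - 1 then (1 : ℝ) else 0) else 0)) *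
              ∑' s : Site (d + 1), ∑ b' : Fin (d + 1), E2 d Lc (j + 1) (toSite x) s (Sum.inl b) (Sum.inl b') *
                ((if b' = ν then ((Lc : ℝ)⁻¹ * (Lc : ℝ)⁻¹) * ((((s β % (Lc : ℤ) : ℤ) : ℝ) - ((Lc : ℝ) - 1) / 2)) else 0)
                  + (if b' = β then (-(Lc : ℝ)⁻¹ * ((((s ν % (Lc : ℤ) : ℤ) : ℝ) - ((Lc : ℝ) - 1) / 2))) * (if s β % (Lc : ℤ) = (Lc : ℤ) - 1 then (1 : ℝ) else 0) else 0))))) := by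
  have hLc : 1 ≤ Lc := one_le_of_neZero Lc
  have hr : ctrOff (d + 1) Lc ∈ box (d + 1) Lc := ctrOff_mem_box (pos_Lc (Lc := Lc))
  rw [exchangeWord_sector_eq_stair cΛt sf sm cE cΛ j μ α ν β]
  -- L4′ in cell form on the two admissible pre-images
  have hval := sum_box_E2T_mul_dressedStep_E2_apply hr sf sm j
    (qL := fun b (y : Site (d + 1)) =>
      (if b = μ then ((Lc : ℝ)⁻¹ * (Lc : ℝ)⁻¹) * ((((y α % (Lc : ℤ) : ℤ) : ℝ) - ((Lc : ℝ) - 1) / 2)) else 0)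
        + (if b = α then (-(Lc : ℝ)⁻¹ * ((((y μ % (Lc : ℤ) : ℤ) : ℝ) - ((Lc : ℝ) - 1) / 2))) * (if y α % (Lc : ℤ) = (Lc : ℤ) - 1 then (1 : ℝ) else 0) else 0))
    (qR := fun b' (s : Site (d + 1)) =>
      (if b' = ν then ((Lc : ℝ)⁻¹ * (Lc : ℝ)⁻¹) * ((((s β % (Lc : ℤ) : ℤ) : ℝ) - ((Lc : ℝ) - 1) / 2)) else 0)
        + (if b' = β then (-(Lc : ℝ)⁻¹ * ((((s ν % (Lc : ℤ) : ℤ) : ℝ) - ((Lc : ℝ) - 1) / 2))) * (if s β % (Lc : ℤ) = (Lc : ℤ) - 1 then (1 : ℝ) else 0) else 0))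
    (fun b y t => qProfile_translate (Lc := Lc) μ α b y t) (fun b' s t => qProfile_translate (Lc := Lc) ν β b' s t)
    (fun b y => abs_qProfile_le (d := d) hLc μ α b y) (fun b' s => abs_qProfile_le (d := d) hLc ν β b' s)
    (fun κ y => contourSum_qProfile_eq_zero (Lc := Lc) hνβ κ y)
  rw [← hval]
  refine congrArg (fun t : ℝ => ((box (d + 1) Lc).card : ℝ) * (((Lc : ℝ) * (sm * sf)) * ((((Lc ^ (j + 1 + 1) : ℕ) : ℝ)) ^ (d + 1 + 1))⁻¹) ^ 2 * t) ?_
  rw [Finset.mul_sum]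
  refine Finset.sum_congr rfl fun x _ => ?_
  rw [Finset.mul_sum]
  refine Finset.sum_congr rfl fun a _ => ?_
  rw [stairFace_eq_periodic_fst (Lc := Lc) j hμα (toSite x) a]
  have hR : ∀ (z : Site (d + 1)) (b : Fin (d + 1)),
      (∑' s : Site (d + 1), E2 d Lc (j + 1) z s (Sum.inl b) (Sum.inl β) * ((((s ν / (Lc : ℤ) : ℤ) : ℝ)) * (if s β % (Lc : ℤ) = (Lc : ℤ) - 1 then (1 : ℝ) else 0))) =
      ∑' s : Site (d + 1), ∑ b' : Fin (d + 1), E2 d Lc (j + 1) z s (Sum.inl b) (Sum.inl b') *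
        ((if b' = ν then ((Lc : ℝ)⁻¹ * (Lc : ℝ)⁻¹) * ((((s β % (Lc : ℤ) : ℤ) : ℝ) - ((Lc : ℝ) - 1) / 2)) else 0)
          + (if b' = β then (-(Lc : ℝ)⁻¹ * ((((s ν % (Lc : ℤ) : ℤ) : ℝ) - ((Lc : ℝ) - 1) / 2))) * (if s β % (Lc : ℤ) = (Lc : ℤ) - 1 then (1 : ℝ) else 0) else 0)) :=
    fun z b => stairFace_eq_periodic (Lc := Lc) j hνβ z b
  simp_rw [hR]
  ring

/-- [folklore] **THE E-SECTOR EE WORD VANISHES ON THE RIGHT-DIAGONAL PATTERNS** (`ν = β`): the right staircase current is zero (`StaircaseCurrentAntisymm.stairFace_diag_eq_zero`). -/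
theorem exchangeWord_sector_eq_zero_of_right_diag (cΛt sf sm cE cΛ : ℝ) (j : ℕ) (μ α ν : Fin (d + 1)) :
    ∑ u ∈ box (d + 1) Lc, ∑' y₁ : Site (d + 1), ∑ a : Fin (d + 1),
        (∑' y : Site (d + 1), (if y α % (Lc : ℤ) = (Lc : ℤ) - 1 then (1 : ℝ) else 0) *
          vertexOfK (unitK sf sm (coDressKBmAt (toSite (ctrOff (d + 1) Lc)) Lc (KInvStep (d := d) Lc (j + 1)))) Lc
            (unitS sf sm (fun κ u => cE • e3OfK Lc (coDressKBmAt (toSite (ctrOff (d + 1) Lc)) Lc (KInvStep (d := d) Lc j))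
              (fun κ u => comp (comp (trK (psiKS (ctrOff (d + 1) Lc) Lc)) (slotPsiS (ctrOff (d + 1) Lc) Lc (ScombOf (symTablesAn1S2 d Lc cΛt) ((Lc : ℝ) ^ (d + 1)) (-((Lc : ℝ) ^ (d + 1) * (1 / 2) * (Lc : ℝ) ^ (d + 1))) cΛ j) κ u)) (psiKS (ctrOff (d + 1) Lc) Lc)) κ u)) μ (toSite u) y y₁ (Sum.inl α) (Sum.inl a)) *
        (∑' z : Site (d + 1), ∑ b : Fin (d + 1), unitK sf sm (coDressKBmAt (toSite (ctrOff (d + 1) Lc)) Lc (KInvStep (d := d) Lc (j + 1))) y₁ z (Sum.inl a) (Sum.inl b) *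
          (∑' u' : Site (d + 1), ∑' w : Site (d + 1), (if w ν % (Lc : ℤ) = (Lc : ℤ) - 1 then (1 : ℝ) else 0) *
            vertexOfK (unitK sf sm (coDressKBmAt (toSite (ctrOff (d + 1) Lc)) Lc (KInvStep (d := d) Lc (j + 1)))) Lc
              (unitS sf sm (fun κ u => cE • e3OfK Lc (coDressKBmAt (toSite (ctrOff (d + 1) Lc)) Lc (KInvStep (d := d) Lc j))
                (fun κ u => comp (comp (trK (psiKS (ctrOff (d + 1) Lc) Lc)) (slotPsiS (ctrOff (d + 1) Lc) Lc (ScombOf (symTablesAn1S2 d Lc cΛt) ((Lc : ℝ) ^ (d + 1)) (-((Lc : ℝ) ^ (d + 1) * (1 / 2) * (Lc : ℝ) ^ (d + 1))) cΛ j) κ u)) (psiKS (ctrOff (d + 1) Lc) Lc)) κ u)) ν u' z w (Sum.inl b) (Sum.inl ν))) = 0 := by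
  rw [exchangeWord_sector_eq_stair cΛt sf sm cE cΛ j μ α ν ν]
  have hR : ∀ (z : Site (d + 1)) (b : Fin (d + 1)),
      (∑' s : Site (d + 1), E2 d Lc (j + 1) z s (Sum.inl b) (Sum.inl ν) * ((((s ν / (Lc : ℤ) : ℤ) : ℝ)) * (if s ν % (Lc : ℤ) = (Lc : ℤ) - 1 then (1 : ℝ) else 0))) = 0 :=
    fun z b => stairFace_diag_eq_zero (Lc := Lc) j ν z b
  simp_rw [hR, mul_zero, Finset.sum_const_zero, tsum_zero, mul_zero, Finset.sum_const_zero, mul_zero]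

/-- [folklore] **THE E-SECTOR EE WORD VANISHES ON THE LEFT-DIAGONAL PATTERNS** (`μ = α`): the left staircase current is zero (`StaircaseCurrentAntisymm.stairFace_diag_eq_zero_fst`). -/
theorem exchangeWord_sector_eq_zero_of_left_diag (cΛt sf sm cE cΛ : ℝ) (j : ℕ) (μ ν β : Fin (d + 1)) :
    ∑ u ∈ box (d + 1) Lc, ∑' y₁ : Site (d + 1), ∑ a : Fin (d + 1),
        (∑' y : Site (d + 1), (if y μ % (Lc : ℤ) = (Lc : ℤ) - 1 then (1 : ℝ) else 0) *
          vertexOfK (unitK sf sm (coDressKBmAt (toSite (ctrOff (d + 1) Lc)) Lc (KInvStep (d := d) Lc (j + 1)))) Lc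
            (unitS sf sm (fun κ u => cE • e3OfK Lc (coDressKBmAt (toSite (ctrOff (d + 1) Lc)) Lc (KInvStep (d := d) Lc j))
              (fun κ u => comp (comp (trK (psiKS (ctrOff (d + 1) Lc) Lc)) (slotPsiS (ctrOff (d + 1) Lc) Lc (ScombOf (symTablesAn1S2 d Lc cΛt) ((Lc : ℝ) ^ (d + 1)) (-((Lc : ℝ) ^ (d + 1) * (1 / 2) * (Lc : ℝ) ^ (d + 1))) cΛ j) κ u)) (psiKS (ctrOff (d + 1) Lc) Lc)) κ u)) μ (toSite u) y y₁ (Sum.inl μ) (Sum.inl a)) *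
        (∑' z : Site (d + 1), ∑ b : Fin (d + 1), unitK sf sm (coDressKBmAt (toSite (ctrOff (d + 1) Lc)) Lc (KInvStep (d := d) Lc (j + 1))) y₁ z (Sum.inl a) (Sum.inl b) *
          (∑' u' : Site (d + 1), ∑' w : Site (d + 1), (if w β % (Lc : ℤ) = (Lc : ℤ) - 1 then (1 : ℝ) else 0) *
            vertexOfK (unitK sf sm (coDressKBmAt (toSite (ctrOff (d + 1) Lc)) Lc (KInvStep (d := d) Lc (j + 1)))) Lc
              (unitS sf sm (fun κ u => cE • e3OfK Lc (coDressKBmAt (toSite (ctrOff (d + 1) Lc)) Lc (KInvStep (d := d) Lc j))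
                (fun κ u => comp (comp (trK (psiKS (ctrOff (d + 1) Lc) Lc)) (slotPsiS (ctrOff (d + 1) Lc) Lc (ScombOf (symTablesAn1S2 d Lc cΛt) ((Lc : ℝ) ^ (d + 1)) (-((Lc : ℝ) ^ (d + 1) * (1 / 2) * (Lc : ℝ) ^ (d + 1))) cΛ j) κ u)) (psiKS (ctrOff (d + 1) Lc) Lc)) κ u)) ν u' z w (Sum.inl b) (Sum.inl β))) = 0 := by
  rw [exchangeWord_sector_eq_stair cΛt sf sm cE cΛ j μ μ ν β]
  have hL : ∀ (x : Fin (d + 1) → ℕ) (a : Fin (d + 1)),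
      (∑' y : Site (d + 1), ((((y μ / (Lc : ℤ) : ℤ) : ℝ)) * (if y μ % (Lc : ℤ) = (Lc : ℤ) - 1 then (1 : ℝ) else 0)) * E2 d Lc (j + 1) y (toSite x) (Sum.inl μ) (Sum.inl a)) = 0 :=
    fun x a => stairFace_diag_eq_zero_fst (Lc := Lc) j μ (toSite x) a
  simp_rw [hL, mul_zero, zero_mul, Finset.sum_const_zero, mul_zero]

end Summit.QuantumFields.BalabanUV.Beta.GAN24.CombExchangeESectorValue

end
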